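import Literature.NumberTheory.Automorphic.ReciprocityGLn
import Literature.NumberTheory.GaloisRepresentations.WeilDeligneRep
import HarnessLib

/-!
# `p`-adic Hodge data at `v ∣ ℓ`: de Rham representations and their Weil–Deligne representations

Trunk: GaloisRepresentations (support for the summit statement `Langlands`, lang.S02:
the "de Rham at `v ∣ ℓ`" clause and local–global compatibility AT the places above `ℓ`).

Let `F` be a non-archimedean local field of residue characteristic `ℓ` (intended: `F = K_v`,
`v ∣ ℓ`) and `ρ : Γ_F →ₜ* GL_n(ℚ̄_ℓ)`. Fontaine attaches to `ρ` the filtered module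
`D_dR(ρ) = (B_dR ⊗ ρ)^{Γ_F}`; `ρ` is *de Rham* iff `dim D_dR(ρ) = n` (Fontaine 1994, Exposé III,
§1.5, §3). A de Rham `ρ` is potentially semistable (Berger 2002), and to the
`(φ, N, Gal(F'/F))`-module `D_pst(ρ)` Fontaine attaches a Weil–Deligne representation `WD(ρ)` of
`W_F` over `ℚ̄_ℓ` (Fontaine 1994, Exposé VIII "Représentations ℓ-adiques potentiellement
semi-stables", §1.3, §2.3.7; Taylor 2004, §1 p. 79–80; Taylor–Yoshida 2007, §1). Local–global
compatibility at `v ∣ ℓ` reads `ι WD(ρ|_{Γ_{F_v}})^{F-ss} ≅ rec(π_v ⊗ |det|^{(1-n)/2})`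
(Taylor 2004, Conj. 3.4–3.5; a theorem in the regular self-dual case: Caraiani 2014).

The accepted tree has Fontaine's *abstract* admissibility formalism (`PeriodRingData`,
`GaloisRep.IsDeRham 𝔅 ρ := dim (B ⊗ ρ)^Γ = dim ρ`, `PAdicHodge`) but NO construction of `B_dR`,
`B_st`, `D_pst` or of `WD ∘ D_pst` (nor has Mathlib), and no `Algebra ℚ_[ℓ] K_v` instance. As in
the accepted `Literature.NumberTheory.Automorphic.DeRhamData` / `FontaineMazurLanglandsGLn 𝔅`, these enter as a DATUM; this
file fixes its type and the two definitions read off it: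

* `Literature.PstWeilDeligneData F ℓ` — fields: a `ℚ_ℓ`-algebra structure on `F`; a period-ring datum
  `𝔅` for `Γ_F` over `ℚ_ℓ` with invariants `F` (INTENDED `B_dR(F)`); a relation
  `IsWeilDeligneOf ρ r` between framed `ρ : Γ_F →ₜ* GL_n(ℚ̄_ℓ)` and Weil–Deligne representations
  `r` over `ℚ̄_ℓ` on `Fin n → ℚ̄_ℓ` (INTENDED: `r ≅ WD(D_pst(ρ))`), subject to the two axioms one
  can state without `D_pst`: every de Rham `ρ` has some `r` (`exists_of_isDeRham`; Berger +
  Fontaine), `r` is unique up to isomorphism (`isEquivalent`), frame-invariance (`conj`), and the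
  unramified case (`isDeRhamWith_of_isLocallyUnramified`, `wd_of_isLocallyUnramified`: unramified
  ⇒ de Rham, `N = 0`, inertia trivial on `WD`). PLACEHOLDER STATUS: the fields
  `𝔅` and `IsWeilDeligneOf` are abstract; the definition items "construct `B_dR(K_v)`" and
  "construct `WD ∘ D_pst`" replace them by the genuine objects. They are NOT unconstrained Props
  in the sense that matters for vacuity: `IsDeRham 𝔅` is Fontaine's honest dimension condition
  for the datum's ring, and `IsWeilDeligneOf` is tied to it by `exists_of_isDeRham`.
* `FramedRep.IsDeRhamWith alg 𝔅 ρ` / `PstWeilDeligneData.IsDeRhamFramed 𝔇 ρ` —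
  `ρ : Γ_F →ₜ* GL_n(ℚ̄_ℓ)` is de Rham: it has a model
  `rE` over a finite `E/ℚ_ℓ` (accepted `HasQlModel`; automatic, accepted named fact
  `exists_hasQlModel`) whose underlying `ℚ_ℓ`-linear representation (accepted
  `restrictScalarsQl`) is `𝔅`-admissible (accepted `GaloisRep.IsDeRham`). Fontaine's theory is
  `ℚ_ℓ`-linear on finite-dimensional spaces, whence the model, exactly as in the accepted lang.S03.

No `sorry`. Universe: `F : Type`, period ring in `Type` (as the accepted `DeRhamData`).

## References

* J.-M. Fontaine, *Le corps des périodes p-adiques*; *Représentations p-adiques semi-stables*;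
  *Représentations ℓ-adiques potentiellement semi-stables*, Astérisque 223 (1994), Exposés II,
  III, VIII. [FontaineAsterisque223III]
* J.-M. Fontaine, B. Mazur, *Geometric Galois representations* (1995), §1.
  [FontaineMazurGeometric1995]
* R. Taylor, *Galois representations*, Ann. Fac. Sci. Toulouse Math. (6) 13 (2004), 73–119
  (long version of the ICM 2002 lecture), §1 (p. 79–80: `WD(ρ)` for de Rham `ρ`), §3 Conj. 3.4,
  3.5. [TaylorGaloisRepresentations2004 — key to be added]
* L. Berger, *Représentations p-adiques et équations différentielles*, Invent. Math. 148 (2002),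
  Thm. 0.7 (de Rham ⇒ potentially semistable). [BergerInventiones2002 — key to be added]
-/

noncomputable section

open Field

namespace Literature.NumberTheory.GaloisRepresentations

section

variable {F : Type} [Field F] [ValuativeRel F] [TopologicalSpace F] [IsNonarchimedeanLocalField F]
  {ℓ : ℕ} [Fact ℓ.Prime]

/-- **`ρ : Γ_F →ₜ* GL_n(ℚ̄_ℓ)` is `𝔅`-de Rham** for a `ℚ_ℓ`-algebra structure `alg` on `F` and a
period-ring datum `𝔅` (intended: `B_dR(F)`): `ρ` has a model `rE` over a finite extension
`E/ℚ_ℓ` inside `ℚ̄_ℓ` (accepted `HasQlModel`) whose underlying `ℚ_ℓ`-linear representation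
(accepted `restrictScalarsQl`) is `𝔅`-admissible, `dim_F (B ⊗_{ℚ_ℓ} rE)^{Γ_F} = n [E : ℚ_ℓ]`
(accepted `GaloisRep.IsDeRham`). Every continuous `ρ` has such a model (accepted named fact
`exists_hasQlModel`) and de Rham-ness does not depend on it (Fontaine's theory is `ℚ_ℓ`-linear
on finite-dimensional spaces, as in the accepted lang.S03). Fontaine 1994, Exposé III §1.5, §3.
[cite: FontaineAsterisque223III, §1.5 and §3] [cite: FontaineMazurGeometric1995, §1] -/
def FramedRep.IsDeRhamWith (alg : Algebra ℚ_[ℓ] F)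
    (𝔅 : PeriodRingData.{0, 0, 0, 0} (absoluteGaloisGroup F) ℚ_[ℓ] F) {n : ℕ}
    (ρ : FramedRep (absoluteGaloisGroup F) (PadicAlgCl ℓ) n) : Prop :=
  ∃ (E : IntermediateField ℚ_[ℓ] (PadicAlgCl ℓ)) (_ : FiniteDimensional ℚ_[ℓ] E)
    (rE : FramedRep (absoluteGaloisGroup F) E n),
    Literature.NumberTheory.Automorphic.HasQlModel ρ E rE ∧
      letI := alg; (Literature.NumberTheory.Automorphic.restrictScalarsQl E rE).IsDeRham 𝔅

/-- `ρ : Γ_F →ₜ* GL_n(A)` is **unramified**: trivial on the inertia group `I_F ≤ Γ_F` of the local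
field `F` (accepted `absInertia`). [cite: TateCorvallis1979, (1.4.1)] -/
def FramedRep.IsLocallyUnramified {A : Type*} [CommRing A] [TopologicalSpace A] {n : ℕ}
    (ρ : FramedRep (absoluteGaloisGroup F) A n) : Prop :=
  ∀ σ ∈ absInertia F, ρ σ = 1

end

/-- **`p`-adic Hodge data for the local field `F` at the prime `ℓ`** (intended: `F = K_v`,
`v ∣ ℓ`). Fields: a `ℚ_ℓ`-algebra structure on `F` (canonical for `K_v`, `v ∣ ℓ`; absent from
Mathlib); a period-ring datum `𝔅` (accepted `PeriodRingData`: a regular `(ℚ_ℓ, Γ_F)`-ring with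
`B^{Γ_F} = F` and a filtration — INTENDED `B_dR(F)`, Fontaine 1994 Exp. II §1.5, III §3); the
relation "`r` is (isomorphic to) the Weil–Deligne representation `WD(D_pst(ρ))` of the de Rham
representation `ρ`" (Fontaine 1994 Exp. VIII §1.3, §2.3.7; Taylor 2004 §1); and the properties of
the genuine objects that the accepted tree can phrase: existence on de Rham `ρ` (Berger 2002 +
Fontaine), uniqueness up to isomorphism, invariance under change of frame, and the unramified
case (unramified ⇒ crystalline ⇒ de Rham, with `N = 0` and inertia acting trivially on `WD`).
[cite: FontaineAsterisque223III, §1.5 and §3] [cite: FontaineMazurGeometric1995, §1] -/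
structure PstWeilDeligneData (F : Type) [Field F] [ValuativeRel F] [TopologicalSpace F]
    [IsNonarchimedeanLocalField F] (ℓ : ℕ) [Fact ℓ.Prime] : Type 1 where
  /-- The `ℚ_ℓ`-algebra structure on `F` (for `F = K_v`, `v ∣ ℓ`: the canonical one). -/
  algebra : Algebra ℚ_[ℓ] F
  /-- The de Rham period ring datum (intended `B_dR(F)` with its `t`-adic filtration). -/
  𝔅 : PeriodRingData.{0, 0, 0, 0} (absoluteGaloisGroup F) ℚ_[ℓ] F
  /-- `r` is a Weil–Deligne representation of `W_F` over `ℚ̄_ℓ` attached to `ρ` through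
  `D_pst` (intended: `r ≅ WD(D_pst(ρ))`, Fontaine 1994, Exposé VIII). -/
  IsWeilDeligneOf : ∀ {n : ℕ}, FramedRep (absoluteGaloisGroup F) (PadicAlgCl ℓ) n →
    WeilDeligneRep F (PadicAlgCl ℓ) (Fin n → PadicAlgCl ℓ) → Prop
  /-- Every de Rham `ρ` has an attached Weil–Deligne representation (de Rham ⇒ potentially
  semistable, Berger 2002, Thm. 0.7; then Fontaine 1994, Exposé VIII §2.3.7). -/
  exists_of_isDeRham : ∀ {n : ℕ} (ρ : FramedRep (absoluteGaloisGroup F) (PadicAlgCl ℓ) n),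
    ρ.IsDeRhamWith algebra 𝔅 → ∃ r, IsWeilDeligneOf ρ r
  /-- The attached Weil–Deligne representation is unique up to isomorphism. -/
  isEquivalent : ∀ {n : ℕ} (ρ : FramedRep (absoluteGaloisGroup F) (PadicAlgCl ℓ) n)
    (r r' : WeilDeligneRep F (PadicAlgCl ℓ) (Fin n → PadicAlgCl ℓ)),
    IsWeilDeligneOf ρ r → IsWeilDeligneOf ρ r' → r.IsEquivalent r'
  /-- `WD` is an isomorphism invariant of `ρ`: it does not see the frame (`FramedRep.conj`). -/
  conj : ∀ {n : ℕ} (g : GL (Fin n) (PadicAlgCl ℓ))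
    (ρ : FramedRep (absoluteGaloisGroup F) (PadicAlgCl ℓ) n)
    (r : WeilDeligneRep F (PadicAlgCl ℓ) (Fin n → PadicAlgCl ℓ)),
    IsWeilDeligneOf ρ r → IsWeilDeligneOf (FramedRep.conj g ρ) r
  /-- Unramified representations are de Rham (unramified ⇒ crystalline ⇒ de Rham;
  Fontaine 1994, Exposé III §5). -/
  isDeRhamWith_of_isLocallyUnramified :
    ∀ {n : ℕ} (ρ : FramedRep (absoluteGaloisGroup F) (PadicAlgCl ℓ) n),
      ρ.IsLocallyUnramified → ρ.IsDeRhamWith algebra 𝔅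
  /-- For unramified (hence crystalline, semistable over `F` itself) `ρ`, `WD(ρ)` has `N = 0` and
  inertia acts trivially (Fontaine 1994, Exposé VIII §1.3, §2.3.7). -/
  wd_of_isLocallyUnramified :
    ∀ {n : ℕ} (ρ : FramedRep (absoluteGaloisGroup F) (PadicAlgCl ℓ) n)
      (r : WeilDeligneRep F (PadicAlgCl ℓ) (Fin n → PadicAlgCl ℓ)),
      ρ.IsLocallyUnramified → IsWeilDeligneOf ρ r → r.N = 0 ∧ WeilGroup.IsUnramifiedRep r.ρ

namespace PstWeilDeligneData

variable {F : Type} [Field F] [ValuativeRel F] [TopologicalSpace F] [IsNonarchimedeanLocalField F]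
  {ℓ : ℕ} [Fact ℓ.Prime]

/-- **`ρ : Γ_F →ₜ* GL_n(ℚ̄_ℓ)` is de Rham** relative to the datum `𝔇` (intended: `B_dR(F)`):
`FramedRep.IsDeRhamWith 𝔇.algebra 𝔇.𝔅 ρ`. Fontaine 1994, Exposé III §1.5, §3; Fontaine–Mazur
1995, §1. [cite: FontaineAsterisque223III, §1.5 and §3] [cite: FontaineMazurGeometric1995, §1] -/
abbrev IsDeRhamFramed (𝔇 : PstWeilDeligneData F ℓ) {n : ℕ}
    (ρ : FramedRep (absoluteGaloisGroup F) (PadicAlgCl ℓ) n) : Prop :=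
  ρ.IsDeRhamWith 𝔇.algebra 𝔇.𝔅

/-- Unramified `ρ` are de Rham for every datum (structure field). [cite: FontaineAsterisque223III, §5] -/
theorem isDeRhamFramed_of_isLocallyUnramified (𝔇 : PstWeilDeligneData F ℓ) {n : ℕ}
    {ρ : FramedRep (absoluteGaloisGroup F) (PadicAlgCl ℓ) n} (h : ρ.IsLocallyUnramified) :
    𝔇.IsDeRhamFramed ρ :=
  𝔇.isDeRhamWith_of_isLocallyUnramified ρ h

/-- A de Rham `ρ` has an attached Weil–Deligne representation (structure field
`exists_of_isDeRham`, restated through `IsDeRhamFramed`). [cite: FontaineAsterisque223III, §1.5] -/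
theorem IsDeRhamFramed.exists_isWeilDeligneOf {𝔇 : PstWeilDeligneData F ℓ} {n : ℕ}
    {ρ : FramedRep (absoluteGaloisGroup F) (PadicAlgCl ℓ) n} (h : 𝔇.IsDeRhamFramed ρ) :
    ∃ r, 𝔇.IsWeilDeligneOf ρ r :=
  𝔇.exists_of_isDeRham ρ h

/-- Two Weil–Deligne representations attached to the same `ρ` are isomorphic (structure field
`isEquivalent`). [cite: FontaineAsterisque223III, §1.5] -/
theorem isWeilDeligneOf_isEquivalent (𝔇 : PstWeilDeligneData F ℓ) {n : ℕ}
    (ρ : FramedRep (absoluteGaloisGroup F) (PadicAlgCl ℓ) n)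
    {r r' : WeilDeligneRep F (PadicAlgCl ℓ) (Fin n → PadicAlgCl ℓ)}
    (h : 𝔇.IsWeilDeligneOf ρ r) (h' : 𝔇.IsWeilDeligneOf ρ r') : r.IsEquivalent r' :=
  𝔇.isEquivalent ρ r r' h h'

end PstWeilDeligneData

/-- **Existence of the genuine datum** (Fontaine's `B_dR(F)` and `WD ∘ D_pst`): for every finite
extension `F` of `ℚ_ℓ` (here: every non-archimedean local field of characteristic zero and residue
characteristic `ℓ`, given as a `ℚ_ℓ`-algebra) there is a `PstWeilDeligneData F ℓ` whose `algebra`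
field is the given structure — the intended instance. Named fact (D-0014); it records that the
type is inhabited by the objects of the literature, and is the target of the definition items
"construct `B_dR`", "construct `WD ∘ D_pst`". [cite: FontaineAsterisque223III, §3] -/
def PstWeilDeligneData.nonempty : Prop :=
  ∀ (F : Type) [Field F] [ValuativeRel F] [TopologicalSpace F] [IsNonarchimedeanLocalField F]
    (ℓ : ℕ) [Fact ℓ.Prime] [CharZero F] (_ : Algebra ℚ_[ℓ] F),
    ∃ 𝔇 : PstWeilDeligneData F ℓ, 𝔇.algebra = ‹Algebra ℚ_[ℓ] F›

end Literature.NumberTheory.GaloisRepresentations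

end
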